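import Summits.CriticalPhenomena.Ising3DConformalLimit.Theses.LinkingParityCircles
import Summits.CriticalPhenomena.Ising3DConformalLimit.Theorems.MoebiusLimitExists.Negative.FreeTranslations
import Summits.CriticalPhenomena.Ising3DConformalLimit.Theorems.HyperoctahedralRPLimitRotationInvariant
import Summits.CriticalPhenomena.Ising3DConformalLimit.Theorems.HyperoctahedralRPHRP2Rigidity
import Summits.CriticalPhenomena.Ising3DConformalLimit.Theorems.LinkingParityCirclesSpinRatioMoebiusStubCellLimitTranslate
import Summits.CriticalPhenomena.Ising3DConformalLimit.Theorems.LinkingParityCirclesSpinRatioMoebiusStubCellLimitContinuous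
import Summits.CriticalPhenomena.Ising3DConformalLimit.Theorems.LinkingParityCirclesSpinRatioMoebiusStubTwoPointOfRatioLimit
import Summits.CriticalPhenomena.Ising3DConformalLimit.Theorems.LinkingParityCirclesSpinRatioMoebiusStubScalingLimitOfRatioLimit
import Summits.CriticalPhenomena.Ising3DConformalLimit.Theorems.LinkingParityCirclesSpinRatioMoebiusTwoPointPrelim
import Summits.CriticalPhenomena.Ising3DConformalLimit.Theses.HyperoctahedralRP
import Literature.Probability.LatticeModels.HighDimPointwiseTriviality
import HarnessLib

/-!
# Crux `LinkingParityCircles.SpinRatioMoebius` (stmt-CriticalPhenomena-4530), line `registered` —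
# the PINNED LIMIT of a family of pairing-ratio limits (Euclidean invariance and scale covariance are free)

Glue of the registered skeleton (`Cruxes/SpinRatioMoebius/Lines/registered.lean`, §4–§5), landed so that the equivalences
`SpinRatioMoebius ⇔ MoebiusLimit (item 1344) ⇔ RatioLimit (4841) ∧ RatioInversionInvariance (4840)` can be stated in the
tree (`…SpinRatioMoebiusEquivalences.lean`).  Given, at every level `m`, a locally uniform limit `q_{2m}` on the locus of
the weight-free spin pairing ratios `Q^δ_m(x) = ⟨∏σ_{[xᵢ/δ]}⟩ / ∏_j ⟨σ_{[x_j/δ]}σ_{[x_{j+m}/δ]}⟩` of the critical Ising model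
on `ℤ³`:
* the limits are translation invariant, continuous and dilation invariant on the locus, and `q_2 ≡ 1`
  (landed stubs `stub_cellLimitTranslate`, `stub_cellLimitContinuous`; exact identities `[c x/δ] = [x/(δ/c)]`,
  `⟨σ_aσ_b⟩/⟨σ_aσ_b⟩ = 1`);
* `pinnedLimit_of_ratioLimits`: the pinned two-point limit `ψ` and the pinned scaling limit `S`
  (`S_{2m} = q_{2m} ∏_j ψ(x_{m+j} − x_j)`, landed stubs `stub_twoPointOfRatioLimit`, `stub_scalingLimitOfRatioLimit`) exist, and
  `S` is `O(3)` invariant by the landed `HyperoctahedralRP` theorems `HRP2Rigidity_of` (item 1979) and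
  `limitRotationInvariant_proof` (item 1980).

References: S. Friedli, Y. Velenik (CUP 2017) Thm. 3.17 (translation invariance of `⟨·⟩⁺`); the `HyperoctahedralRP`
route file for the rigidity theorems.
-/

noncomputable section

namespace Summit.CriticalPhenomena.Ising3DConformalLimit.Cruxes.SpinRatioMoebius.Birth

open Literature.Probability.LatticeModels Filter Set
open Summit.CriticalPhenomena.Ising3DConformalLimit.MoebiusLimitExistsNegative
open Summit.CriticalPhenomena.Ising3DConformalLimit.Cruxes.IsingEuclidUpgradeR4NonGaussian.FreeCovarianceDeltaDichotomy
  (criticalCorr_two_pos')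
open Summit.CriticalPhenomena.Ising3DConformalLimit.Theorems.MoebiusLimitOfTwoPointLaw.Negative (tendsto_div_const_nhdsGT)
open scoped Topology

/-! ## §A Exact lattice identities of the pairing ratio -/

/-- Injective maps of `ℝ^d` preserve and reflect non-coincidence of configurations. [folklore] -/
theorem comp_mem_nonCoincident_iff_of_injective {d n : ℕ} {φ : EuclideanSpace ℝ (Fin d) → EuclideanSpace ℝ (Fin d)}
    (hφ : Function.Injective φ) (x : Fin n → EuclideanSpace ℝ (Fin d)) :
    (fun i => φ (x i)) ∈ NonCoincident d n ↔ x ∈ NonCoincident d n := by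
  rw [mem_nonCoincident, mem_nonCoincident]
  exact hφ.of_comp_iff x

/-- DILATION IS A MESH CHANGE: the pairing ratio of `c • x` at mesh `δ` is the pairing ratio of `x` at mesh `δ / c`. [folklore] -/
theorem ratioFn_smul (m : ℕ) (δ c : ℝ) (x : Fin (m + m) → EuclideanSpace ℝ (Fin 3)) :
    criticalCorr 3 (m + m) (fun i => latticeApprox δ (c • x i)) /
        ∏ j : Fin m, criticalCorr 3 2 ![latticeApprox δ (c • x (Fin.castAdd m j)), latticeApprox δ (c • x (Fin.natAdd m j))] =
      criticalCorr 3 (m + m) (fun i => latticeApprox (δ / c) (x i)) /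
        ∏ j : Fin m, criticalCorr 3 2 ![latticeApprox (δ / c) (x (Fin.castAdd m j)), latticeApprox (δ / c) (x (Fin.natAdd m j))] := by
  simp only [Theorems.MoebiusLimitOfTwoPointLaw.Negative.latticeApprox_smul]

/-- The pairing ratio is invariant under the common lattice translations `xᵢ ↦ xᵢ + δ • k`
(translation invariance of `⟨·⟩⁺_{β_c}`). [cite: FriedliVelenik2017, Thm. 3.17] -/
theorem ratioFn_shift {δ : ℝ} (hδ : 0 < δ) (m : ℕ) (x : Fin (m + m) → EuclideanSpace ℝ (Fin 3)) (k : Site 3) :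
    criticalCorr 3 (m + m) (fun i => latticeApprox δ (x i + δ • siteVec k)) /
        ∏ j : Fin m, criticalCorr 3 2 ![latticeApprox δ (x (Fin.castAdd m j) + δ • siteVec k),
          latticeApprox δ (x (Fin.natAdd m j) + δ • siteVec k)] =
      criticalCorr 3 (m + m) (fun i => latticeApprox δ (x i)) /
        ∏ j : Fin m, criticalCorr 3 2 ![latticeApprox δ (x (Fin.castAdd m j)), latticeApprox δ (x (Fin.natAdd m j))] := by
  simp only [latticeApprox_add_mesh_smul' hδ]
  rw [criticalCorr_translate]
  congr 1
  refine Finset.prod_congr rfl fun j _ => ?_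
  have h : (![latticeApprox δ (x (Fin.castAdd m j)) + k, latticeApprox δ (x (Fin.natAdd m j)) + k] : Fin 2 → Site 3) =
      fun i => ![latticeApprox δ (x (Fin.castAdd m j)), latticeApprox δ (x (Fin.natAdd m j))] i + k := by
    funext i; fin_cases i <;> rfl
  rw [h, criticalCorr_translate]

/-- The pairing ratio is a CELL functional: it depends on `x` only through the cells `⌊x i j / δ⌋`. [folklore] -/
theorem ratioFn_cell (m : ℕ) (δ : ℝ) {x y : Fin (m + m) → EuclideanSpace ℝ (Fin 3)}
    (h : ∀ i j, ⌊x i j / δ⌋ = ⌊y i j / δ⌋) :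
    criticalCorr 3 (m + m) (fun i => latticeApprox δ (x i)) /
        ∏ j : Fin m, criticalCorr 3 2 ![latticeApprox δ (x (Fin.castAdd m j)), latticeApprox δ (x (Fin.natAdd m j))] =
      criticalCorr 3 (m + m) (fun i => latticeApprox δ (y i)) /
        ∏ j : Fin m, criticalCorr 3 2 ![latticeApprox δ (y (Fin.castAdd m j)), latticeApprox δ (y (Fin.natAdd m j))] := by
  have hL : ∀ i, latticeApprox δ (x i) = latticeApprox δ (y i) := fun i => funext fun j => by
    rw [latticeApprox_apply, latticeApprox_apply, h i j]
  simp only [hL]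

/-! ## §B Limit uniqueness along the mesh filter -/

/-- SYMMETRY TRANSFER: a locally uniform limit takes equal values at two points of the set where the approximants are
asymptotically equal along the mesh filter. [folklore] -/
theorem locallyUniformLimit_eq_of_tendsto_sub {X : Type*} [TopologicalSpace X] {F : ℝ → X → ℝ} {g : X → ℝ} {s : Set X}
    (hg : TendstoLocallyUniformlyOn F g (𝓝[>] (0 : ℝ)) s) {x y : X} (hx : x ∈ s) (hy : y ∈ s)
    (h : Tendsto (fun δ : ℝ => F δ y - F δ x) (𝓝[>] (0 : ℝ)) (𝓝 0)) : g y = g x := by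
  have hab : g y - g x = 0 := tendsto_nhds_unique ((hg.tendsto_at hy).sub (hg.tendsto_at hx)) h
  linarith

/-- Conversely, equal limit values give asymptotically equal approximants. [folklore] -/
theorem tendsto_sub_of_locallyUniformLimit_eq {X : Type*} [TopologicalSpace X] {F : ℝ → X → ℝ} {g : X → ℝ} {s : Set X}
    (hg : TendstoLocallyUniformlyOn F g (𝓝[>] (0 : ℝ)) s) {x y : X} (hx : x ∈ s) (hy : y ∈ s) (h : g y = g x) :
    Tendsto (fun δ : ℝ => F δ y - F δ x) (𝓝[>] (0 : ℝ)) (𝓝 0) := by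
  have h' := (hg.tendsto_at hy).sub (hg.tendsto_at hx)
  rw [h, sub_self] at h'
  exact h'

/-! ## §C The free symmetries of a family of ratio limits -/

section RatioLimits

variable {q : CorrFamily 3}

/-- DILATION INVARIANCE IS FREE: a locally uniform ratio limit is invariant under `x ↦ c • x`, `c > 0`, on the locus
(exact identity `ratioFn_smul` + dilation invariance of the mesh filter). [folklore] -/
theorem ratioLimits_smul {m : ℕ}
    (hq : TendstoLocallyUniformlyOn (fun (δ : ℝ) (x : Fin (m + m) → EuclideanSpace ℝ (Fin 3)) =>
      criticalCorr 3 (m + m) (fun i => latticeApprox δ (x i)) /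
        ∏ j : Fin m, criticalCorr 3 2 ![latticeApprox δ (x (Fin.castAdd m j)), latticeApprox δ (x (Fin.natAdd m j))])
      (q (m + m)) (𝓝[>] (0 : ℝ)) (NonCoincident 3 (m + m)))
    {c : ℝ} (hc : 0 < c) {x : Fin (m + m) → EuclideanSpace ℝ (Fin 3)} (hx : x ∈ NonCoincident 3 (m + m)) :
    q (m + m) (fun i => c • x i) = q (m + m) x := by
  have hcx : (fun i => c • x i) ∈ NonCoincident 3 (m + m) :=
    (comp_mem_nonCoincident_iff_of_injective (smul_right_injective _ hc.ne') x).2 hx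
  have h1 := hq.tendsto_at hcx
  have h2 := (hq.tendsto_at hx).comp (tendsto_div_const_nhdsGT hc)
  simp only [Function.comp_def, ratioFn_smul] at h1 h2
  exact tendsto_nhds_unique h1 h2

/-- TRANSLATION INVARIANCE IS FREE (`stub_cellLimitTranslate` applied to the lattice-shift invariant pairing ratio).
[cite: FriedliVelenik2017, Thm. 3.17] -/
theorem ratioLimits_translate {m : ℕ}
    (hq : TendstoLocallyUniformlyOn (fun (δ : ℝ) (x : Fin (m + m) → EuclideanSpace ℝ (Fin 3)) =>
      criticalCorr 3 (m + m) (fun i => latticeApprox δ (x i)) /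
        ∏ j : Fin m, criticalCorr 3 2 ![latticeApprox δ (x (Fin.castAdd m j)), latticeApprox δ (x (Fin.natAdd m j))])
      (q (m + m)) (𝓝[>] (0 : ℝ)) (NonCoincident 3 (m + m)))
    (v : EuclideanSpace ℝ (Fin 3)) {x : Fin (m + m) → EuclideanSpace ℝ (Fin 3)} (hx : x ∈ NonCoincident 3 (m + m)) :
    q (m + m) (fun i => x i + v) = q (m + m) x :=
  stub_cellLimitTranslate (m + m) _ (q (m + m)) (fun _ hδ x k => ratioFn_shift hδ m x k) hq v x hx

/-- CONTINUITY IS FREE (`stub_cellLimitContinuous` applied to the pairing ratio, a translation invariant cell functional).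
[folklore] -/
theorem ratioLimits_continuousOn {m : ℕ}
    (hq : TendstoLocallyUniformlyOn (fun (δ : ℝ) (x : Fin (m + m) → EuclideanSpace ℝ (Fin 3)) =>
      criticalCorr 3 (m + m) (fun i => latticeApprox δ (x i)) /
        ∏ j : Fin m, criticalCorr 3 2 ![latticeApprox δ (x (Fin.castAdd m j)), latticeApprox δ (x (Fin.natAdd m j))])
      (q (m + m)) (𝓝[>] (0 : ℝ)) (NonCoincident 3 (m + m))) :
    ContinuousOn (q (m + m)) (NonCoincident 3 (m + m)) :=
  stub_cellLimitContinuous (m + m) _ (q (m + m)) (fun δ _ _ _ h => ratioFn_cell m δ h)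
    (fun v _ hx => ratioLimits_translate hq v hx) hq

/-- At level `1 + 1` every ratio limit is `1` on the locus (`⟨σ_aσ_b⟩/⟨σ_aσ_b⟩ = 1`). [folklore] -/
theorem ratioLimits_level_one
    (hq : TendstoLocallyUniformlyOn (fun (δ : ℝ) (x : Fin (1 + 1) → EuclideanSpace ℝ (Fin 3)) =>
      criticalCorr 3 (1 + 1) (fun i => latticeApprox δ (x i)) /
        ∏ j : Fin 1, criticalCorr 3 2 ![latticeApprox δ (x (Fin.castAdd 1 j)), latticeApprox δ (x (Fin.natAdd 1 j))])
      (q (1 + 1)) (𝓝[>] (0 : ℝ)) (NonCoincident 3 (1 + 1)))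
    {x : Fin (1 + 1) → EuclideanSpace ℝ (Fin 3)} (hx : x ∈ NonCoincident 3 (1 + 1)) : q (1 + 1) x = 1 := by
  have h1 := hq.tendsto_at hx
  simp only [pairingRatio_level_one] at h1
  exact tendsto_nhds_unique h1 tendsto_const_nhds

end RatioLimits

/-- **THE PINNED LIMIT.** From ratio limits at every level, the landed stubs build the pinned two-point limit `ψ` and the
pinned scaling limit `S` (`S_{2m} = q_{2m} ∏_j ψ(x_{m+j} − x_j)` on the locus, `0` off it), which is translation invariant,
scale covariant with dimension `Δ`, and `O(3)` invariant by the landed `HyperoctahedralRP` rigidity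
(`HRP2Rigidity_of`, `limitRotationInvariant_proof`). [folklore] -/
theorem pinnedLimit_of_ratioLimits :
    ∀ {q : Literature.Probability.LatticeModels.CorrFamily 3}, (∀ m : ℕ, TendstoLocallyUniformlyOn (fun (δ : ℝ) (x : Fin (m + m) → EuclideanSpace ℝ (Fin 3)) => Literature.Probability.LatticeModels.criticalCorr 3 (m + m) (fun i => Literature.Probability.LatticeModels.latticeApprox δ (x i)) / ∏ j : Fin m, Literature.Probability.LatticeModels.criticalCorr 3 2 ![Literature.Probability.LatticeModels.latticeApprox δ (x (Fin.castAdd m j)), Literature.Probability.LatticeModels.latticeApprox δ (x (Fin.natAdd m j))]) (q (m + m)) (nhdsWithin 0 (Set.Ioi 0)) (Literature.Probability.LatticeModels.NonCoincident 3 (m + m))) → ∃ (ρ : ℝ → ℝ) (Δ : ℝ) (ψ : EuclideanSpace ℝ (Fin 3) → ℝ) (S : Literature.Probability.LatticeModels.CorrFamily 3), (∀ δ ∈ Set.Ioc (0 : ℝ) 1, 0 < ρ δ) ∧ Literature.Probability.LatticeModels.HasPointwiseScalingLimit (Literature.Probability.LatticeModels.criticalCorr 3) ρ S ∧ (∀ (n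 : ℕ) (z : Fin n → EuclideanSpace ℝ (Fin 3)), z ∉ Literature.Probability.LatticeModels.NonCoincident 3 n → S n z = 0) ∧ Literature.Probability.LatticeModels.IsNondegenerateTwoPoint S ∧ Literature.Probability.LatticeModels.IsTranslationInvariant S ∧ Literature.Probability.LatticeModels.IsScaleCovariant Δ S ∧ Literature.Probability.LatticeModels.IsRotationInvariant S ∧ (∀ u : EuclideanSpace ℝ (Fin 3), u ≠ 0 → 0 < ψ u) ∧ (∀ m : ℕ, ∀ x ∈ Literature.Probability.LatticeModels.NonCoincident 3 (m + m), S (m + m) x = q (m + m) x * ∏ j : Fin m, ψ (x (Fin.natAdd m j) - x (Fin.castAdd m j))) ∧ (∀ a b : EuclideanSpace ℝ (Fin 3), a ≠ b → S 2 ![a, b] = ψ (b - a)) := by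
  intro q hq
  -- the free inputs
  have hcont : ∀ m : ℕ, ContinuousOn (q (m + m)) (NonCoincident 3 (m + m)) :=
    fun m => ratioLimits_continuousOn (hq m)
  have htrans : ∀ (m : ℕ) (v : EuclideanSpace ℝ (Fin 3)), ∀ x ∈ NonCoincident 3 (m + m),
      q (m + m) (fun i => x i + v) = q (m + m) x := fun m v x hx => ratioLimits_translate (hq m) v hx
  have hdil : ∀ (m : ℕ) (c : ℝ), 0 < c → ∀ x ∈ NonCoincident 3 (m + m),
      q (m + m) (fun i => c • x i) = q (m + m) x := fun m c hc x hx => ratioLimits_smul (hq m) hc hx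
  -- the pinned two-point limit and the pinned scaling limit
  obtain ⟨Δ, ψ, hψc, hψpos, hψhom, h2pt⟩ := stub_twoPointOfRatioLimit (q (2 + 2)) (hq 2) (hcont 2) (htrans 2)
  obtain ⟨ρ, S, hρ, hS, hnorm, hnd, htr, hsc, hform⟩ :=
    stub_scalingLimitOfRatioLimit q Δ ψ hq hcont htrans hdil hψc hψpos hψhom h2pt
  -- every such limit is `O(3)` invariant (route HyperoctahedralRP, items 1979/1980, landed)
  have hrot : IsRotationInvariant S :=
    Cruxes.LimitRotationInvariant.QuarterTurnLiouville.limitRotationInvariant_proof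
      Cruxes.HRP2Rigidity.XRayMellin.HRP2Rigidity_of ρ Δ S hρ hS hnorm hnd htr hsc
  refine ⟨ρ, Δ, ψ, S, hρ, hS, hnorm, hnd, htr, hsc, hrot, hψpos, hform, ?_⟩
  -- `S 2 (a, b) = ψ (b - a)`
  intro a b hab
  have hc : (![a, b] : Fin (1 + 1) → EuclideanSpace ℝ (Fin 3)) ∈ NonCoincident 3 (1 + 1) := pair_mem_nonCoincident hab
  have h1 := hform 1 _ hc
  rw [ratioLimits_level_one (hq 1) hc] at h1
  have e3 : (![a, b] : Fin (1 + 1) → EuclideanSpace ℝ (Fin 3)) (Fin.natAdd 1 (0 : Fin 1)) = b := rfl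
  have e4 : (![a, b] : Fin (1 + 1) → EuclideanSpace ℝ (Fin 3)) (Fin.castAdd 1 (0 : Fin 1)) = a := rfl
  simp only [Fin.prod_univ_one, one_mul, e3, e4] at h1
  exact h1


end Summit.CriticalPhenomena.Ising3DConformalLimit.Cruxes.SpinRatioMoebius.Birth

end
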